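import Mathlib
import Summits.ValiantsHypothesis.ValiantsHypothesis.Theorems.RigidityForcesSymmetryRankRigidMinimalReprLaplaceFiveSeparatedCaptureEqualLines
import Summits.ValiantsHypothesis.ValiantsHypothesis.Theorems.RigidityForcesSymmetryRankRigidMinimalReprLaplaceFiveSeparatedCapture
import Summits.ValiantsHypothesis.ValiantsHypothesis.Theorems.RigidityForcesSymmetryRankRigidMinimalReprLaplaceFivePropA

/-!
# ValiantsHypothesis / RigidityForcesSymmetry — crux `LaplaceOptimalFive` (stmt-ValiantsHypothesis-24813), young-shadow K1:
# **K1 ON `K₃ ⊔ K₂` FOR EQUAL TRIANGLE LINES — UNCONDITIONAL**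

First unconditional piece of K1 on the last `k = 4` family `K₃ ⊔ K₂ = {01, 02, 12, 34}` beyond its sub-supports: a side-symmetric
split decomposition of `P₅` on that support all of whose TRIANGLE short factors read one and the same symmetric letter matrix `g`
(up to scalars — e.g. the same letter-pair indicator `[{v_a, v_b} = {p, q}]` on the three cuts `{0,1}, {0,2}, {1,2}`, the Laplace-atom
pattern; any multiplicities; leaf factors and all long factors arbitrary; off-shell allowed) has Laplace weight `≥ 5! = 120`.
Mechanism: ✓ `stub_obligation_captured` (idea #8) + the EQUAL-LINES case of the symmetric capture inequality
✓ `finrank_le_three_of_equalLines` (memo `pub/val-lit/lmr/NOTE-p4g17-24813-K32-symmetric-capture.md` §10): the captured space has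
dimension `≥ 10 − n₃₄` and `≤ 3`, so the leaf carries ≥ 7 terms and each triangle cut ≥ 1; an empty triangle cut leaves ≤ 3 distinct
splits, where ✓ `LaplaceFivePropA.sideSym_threePairSplits` applies.

* `L3_le_line_form` — reading: with the three spans inside `ℂ·g`, every element of `L3` is `g(p,q)a_r + g(p,r)b_q + g(q,r)c_p`.
* ★ `sideSym_K32canon_equalLines` — the theorem (canonical placement `{01,02,12,34}`).
* `captureIneqSym_equalLines` — the same slice in `CaptureIneqSym`'s own currency: `U₀₁ = U₀₂ = U₁₂ = ℂ·u`, `u ≠ 0` ⇒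
  `finrank W ≤ finrank U₀₁ + finrank U₀₂ + finrank U₁₂`.

Honest framing.  A SUB-CASE of K1 on `K₃ ⊔ K₂` (equal triangle lines); K1 on `K₃ ⊔ K₂` in general, `CaptureIneqSym`, S2′,
`LaplaceOptimalFive` (OPEN · CONTESTED 72/120), `RankRigidMinimalRepr`, `VP ≠ VNP` are NOT proved.  No definitions, no `sorry`.
-/

set_option linter.dupNamespace false
set_option autoImplicit false

namespace Summit.ValiantsHypothesis.ValiantsHypothesis.Theorems.RigidityForcesSymmetryRankRigidMinimalRepr

namespace LaplaceFiveSeparatedCapture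

open Finset LaplaceFiveSectorSplit

/-! ### Reading: `L3` of three spans inside one line `ℂ·g` -/

/-- If the three triangle spans lie in one line `ℂ·g`, every element of `L3` is `g(p,q)a_r + g(p,r)b_q + g(q,r)c_p`. [folklore] -/
theorem L3_le_line_form (g : Fin 5 → Fin 5 → ℂ) (U01 U02 U12 : Submodule ℂ (Fin 5 → Fin 5 → ℂ))
    (h01 : ∀ x ∈ U01, ∃ κ : ℂ, x = κ • g) (h02 : ∀ x ∈ U02, ∃ κ : ℂ, x = κ • g) (h12 : ∀ x ∈ U12, ∃ κ : ℂ, x = κ • g)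
    (X : Fin 5 → Fin 5 → Fin 5 → ℂ) (hX : X ∈ L3 U01 U02 U12) :
    ∃ a b c : Fin 5 → ℂ, ∀ p q r, X p q r = g p q * a r + g p r * b q + g q r * c p := by
  unfold L3 at hX
  refine Submodule.span_induction ?_ ?_ ?_ ?_ hX
  · rintro Y hY
    simp only [Set.mem_union, Set.mem_setOf_eq] at hY
    rcases hY with (⟨x, hx, y, rfl⟩ | ⟨x, hx, y, rfl⟩) | ⟨x, hx, y, rfl⟩
    · obtain ⟨κ, rfl⟩ := h01 x hx
      exact ⟨κ • y, 0, 0, fun p q r => by simp [Pi.smul_apply, smul_eq_mul]; ring⟩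
    · obtain ⟨κ, rfl⟩ := h02 x hx
      exact ⟨0, κ • y, 0, fun p q r => by simp [Pi.smul_apply, smul_eq_mul]; ring⟩
    · obtain ⟨κ, rfl⟩ := h12 x hx
      exact ⟨0, 0, κ • y, fun p q r => by simp [Pi.smul_apply, smul_eq_mul]; ring⟩
  · exact ⟨0, 0, 0, fun p q r => by simp⟩
  · rintro Y Z - - ⟨a, b, c, hY⟩ ⟨a', b', c', hZ⟩
    exact ⟨a + a', b + b', c + c', fun p q r => by simp only [Pi.add_apply, hY, hZ]; ring⟩
  · rintro κ Y - ⟨a, b, c, hY⟩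
    exact ⟨κ • a, κ • b, κ • c, fun p q r => by simp only [Pi.smul_apply, smul_eq_mul, hY]; ring⟩

set_option maxHeartbeats 1600000 in
/-- ★ **K1 ON `K₃ ⊔ K₂ = {01,02,12,34}` FOR EQUAL TRIANGLE LINES — UNCONDITIONAL.**  A side-symmetric split decomposition of `P₅`
supported on the triangle `{0,1}, {0,2}, {1,2}` plus the disjoint edge `{3,4}`, all of whose TRIANGLE short factors read one and the
same symmetric letter matrix `g` (up to scalars; any multiplicities; leaf factors and all long factors arbitrary; off-shell allowed),
has Laplace weight `≥ 5! = 120`.  If some triangle cut carries no term the support has ≤ 3 distinct splits and ✓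
`LaplaceFivePropA.sideSym_threePairSplits` applies; otherwise the captured space has dimension `≥ 10 − n₃₄` and `≤ 3`
(`finrank_le_three_of_equalLines`), so `n₃₄ ≥ 7` and `|T| ≥ 10`. [folklore] -/
theorem sideSym_K32canon_equalLines {N : ℕ} (T : Finset (Fin N)) (S : Fin N → Finset (Fin 5))
    (u w : Fin N → (Fin 5 → Fin 5) → ℂ) (hdec : IsSplitDecomposition T S u w) (hsym : SideSymmetric T S u w)
    (hC : ∀ t ∈ T, S t = ({0, 1} : Finset (Fin 5)) ∨ S t = ({0, 2} : Finset (Fin 5)) ∨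
      S t = ({1, 2} : Finset (Fin 5)) ∨ S t = ({3, 4} : Finset (Fin 5)))
    (g : Fin 5 → Fin 5 → ℂ) (hg : ∀ p q, g p q = g q p)
    (h01 : ∀ t ∈ T, S t = ({0, 1} : Finset (Fin 5)) → ∃ κ : ℂ, short2 (u t) 0 1 = κ • g)
    (h02 : ∀ t ∈ T, S t = ({0, 2} : Finset (Fin 5)) → ∃ κ : ℂ, short2 (u t) 0 2 = κ • g)
    (h12 : ∀ t ∈ T, S t = ({1, 2} : Finset (Fin 5)) → ∃ κ : ℂ, short2 (u t) 1 2 = κ • g) :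
    Nat.factorial 5 ≤ laplaceWeight T S := by
  classical
  have hpair : ∀ t ∈ T, (S t).card = 2 := by
    intro t ht
    rcases hC t ht with h | h | h | h <;> rw [h] <;> decide
  -- Case A: some triangle cut is empty ⇒ at most three distinct splits ⇒ Prop A
  by_cases hne : (∃ t ∈ T, S t = ({0, 1} : Finset (Fin 5))) ∧ (∃ t ∈ T, S t = ({0, 2} : Finset (Fin 5))) ∧
      (∃ t ∈ T, S t = ({1, 2} : Finset (Fin 5)))
  swap
  · apply LaplaceFivePropA.sideSym_threePairSplits N T S u w hdec hsym hpair
    have hsub : ∀ A₀ : Finset (Fin 5), (¬ ∃ t ∈ T, S t = A₀) →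
        (A₀ = {0, 1} ∨ A₀ = {0, 2} ∨ A₀ = {1, 2}) →
        T.image S ⊆ ({({0, 1} : Finset (Fin 5)), {0, 2}, {1, 2}, {3, 4}} : Finset (Finset (Fin 5))).erase A₀ := by
      intro A₀ hno _ A hA
      rw [Finset.mem_image] at hA
      obtain ⟨t, ht, rfl⟩ := hA
      rw [Finset.mem_erase]
      refine ⟨fun h => hno ⟨t, ht, h⟩, ?_⟩
      rcases hC t ht with h | h | h | h <;> simp [h]
    have hcard4 : (({({0, 1} : Finset (Fin 5)), {0, 2}, {1, 2}, {3, 4}} : Finset (Finset (Fin 5)))).card = 4 := by decide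
    rw [not_and_or, not_and_or] at hne
    rcases hne with h | h | h
    · have := Finset.card_le_card (hsub {0, 1} h (Or.inl rfl))
      rw [Finset.card_erase_of_mem (by decide), hcard4] at this
      exact this
    · have := Finset.card_le_card (hsub {0, 2} h (Or.inr (Or.inl rfl)))
      rw [Finset.card_erase_of_mem (by decide), hcard4] at this
      exact this
    · have := Finset.card_le_card (hsub {1, 2} h (Or.inr (Or.inr rfl)))
      rw [Finset.card_erase_of_mem (by decide), hcard4] at this
      exact this
  -- Case B: all three triangle cuts are non-empty
  obtain ⟨⟨t₁, ht₁, hS₁⟩, ⟨t₂, ht₂, hS₂⟩, ⟨t₃, ht₃, hS₃⟩⟩ := hne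
  obtain ⟨hcu, hcw, hid⟩ := hdec
  have hex : ∀ v : Fin 5 → Fin 5, (∑ t ∈ T, u t v * w t v) = perm5 v := fun v => by rw [hid v]; rfl
  have hsep : SepProfile34 T S := hC
  /- spans inside the line ℂ·g -/
  have hspan : ∀ a b : Fin 5, (∀ t ∈ T, S t = ({a, b} : Finset (Fin 5)) → ∃ κ : ℂ, short2 (u t) a b = κ • g) →
      ∀ x ∈ shortSpan T S u a b, ∃ κ : ℂ, x = κ • g := by
    intro a b hab x hx
    unfold shortSpan at hx
    refine Submodule.span_induction ?_ ?_ ?_ ?_ hx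
    · rintro y ⟨t, ⟨ht, hSt⟩, rfl⟩
      exact hab t ht hSt
    · exact ⟨0, by simp⟩
    · rintro y z - - ⟨κ, rfl⟩ ⟨κ', rfl⟩
      exact ⟨κ + κ', by rw [add_smul]⟩
    · rintro r y - ⟨κ, rfl⟩
      exact ⟨r * κ, by rw [mul_smul]⟩
  /- (1) weight = 12·|T| and the four cut classes -/
  have hweight : laplaceWeight T S = 12 * T.card := by
    unfold laplaceWeight
    rw [Finset.sum_congr rfl (g := fun _ => 12) ?_]
    · simp [mul_comm]
    · intro t ht
      rcases hC t ht with h | h | h | h <;> rw [h] <;> decide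
  have hcount :
      (T.filter (fun t => S t = ({0, 1} : Finset (Fin 5)))).card
        + (T.filter (fun t => S t = ({0, 2} : Finset (Fin 5)))).card
        + (T.filter (fun t => S t = ({1, 2} : Finset (Fin 5)))).card
        + (T.filter (fun t => S t = ({3, 4} : Finset (Fin 5)))).card ≤ T.card := by
    rw [Finset.card_filter, Finset.card_filter, Finset.card_filter, Finset.card_filter,
      ← Finset.sum_add_distrib, ← Finset.sum_add_distrib, ← Finset.sum_add_distrib, Finset.card_eq_sum_ones T]
    apply Finset.sum_le_sum
    intro t ht
    rcases hC t ht with h | h | h | h <;> rw [h] <;> decide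
  have hn01 : 1 ≤ (T.filter (fun t => S t = ({0, 1} : Finset (Fin 5)))).card :=
    Finset.card_pos.mpr ⟨t₁, Finset.mem_filter.mpr ⟨ht₁, hS₁⟩⟩
  have hn02 : 1 ≤ (T.filter (fun t => S t = ({0, 2} : Finset (Fin 5)))).card :=
    Finset.card_pos.mpr ⟨t₂, Finset.mem_filter.mpr ⟨ht₂, hS₂⟩⟩
  have hn12 : 1 ≤ (T.filter (fun t => S t = ({1, 2} : Finset (Fin 5)))).card :=
    Finset.card_pos.mpr ⟨t₃, Finset.mem_filter.mpr ⟨ht₃, hS₃⟩⟩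
  /- (2) coordinates for the symmetric zero-diagonal leaf matrices -/
  let P := {x : Fin 5 × Fin 5 // x.1 < x.2}
  have hP : Fintype.card P = 10 := by decide
  let LsymFun : (P → ℂ) → (Fin 5 → Fin 5 → ℂ) := fun c s t =>
    if h : s < t then c ⟨(s, t), h⟩ else if h' : t < s then c ⟨(t, s), h'⟩ else 0
  let Lsym : (P → ℂ) →ₗ[ℂ] (Fin 5 → Fin 5 → ℂ) :=
    { toFun := LsymFun
      map_add' := by
        intro c c'
        funext s t
        simp only [LsymFun, Pi.add_apply]
        split_ifs <;> simp
      map_smul' := by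
        intro r c
        funext s t
        simp only [LsymFun, Pi.smul_apply, smul_eq_mul, RingHom.id_apply]
        split_ifs <;> simp }
  have hLsym_apply : ∀ c s t, Lsym c s t = LsymFun c s t := fun _ _ _ => rfl
  have hinj : Function.Injective Lsym := by
    intro c c' h
    funext π
    have := congr_fun (congr_fun h π.1.1) π.1.2
    simpa [hLsym_apply, LsymFun, π.2] using this
  have hsymL : ∀ c (s t : Fin 5), Lsym c s t = Lsym c t s := by
    intro c s t
    simp only [hLsym_apply, LsymFun]
    rcases lt_trichotomy s t with h | rfl | h
    · simp [h, not_lt.mpr h.le]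
    · simp
    · simp [h, not_lt.mpr h.le]
  have hdiag : ∀ c (s : Fin 5), Lsym c s s = 0 := by
    intro c s
    simp [hLsym_apply, LsymFun]
  /- (3) the leaf evaluation map and its kernel -/
  let ev : (Fin 5 → Fin 5 → ℂ) →ₗ[ℂ] ((T.filter (fun t => S t = ({3, 4} : Finset (Fin 5)))) → ℂ) :=
    { toFun := fun M t => ∑ s : Fin 5, ∑ s' : Fin 5, M s s' * short2 (u t.1) 3 4 s s'
      map_add' := by
        intro M M'
        funext t
        simp only [Pi.add_apply, add_mul, Finset.sum_add_distrib]
      map_smul' := by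
        intro r M
        funext t
        simp only [Pi.smul_apply, smul_eq_mul, RingHom.id_apply, Finset.mul_sum, mul_assoc] }
  have hev_apply : ∀ M t, ev M t = ∑ s : Fin 5, ∑ s' : Fin 5, M s s' * short2 (u t.1) 3 4 s s' :=
    fun _ _ => rfl
  let ev' : (P → ℂ) →ₗ[ℂ] ((T.filter (fun t => S t = ({3, 4} : Finset (Fin 5)))) → ℂ) := ev ∘ₗ Lsym
  have hrn := LinearMap.finrank_range_add_finrank_ker ev'
  rw [Module.finrank_fintype_fun_eq_card, hP] at hrn
  have hrange : Module.finrank ℂ (LinearMap.range ev')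
      ≤ (T.filter (fun t => S t = ({3, 4} : Finset (Fin 5)))).card := by
    have := Submodule.finrank_le (LinearMap.range ev')
    rwa [Module.finrank_fintype_fun_eq_card, Fintype.card_coe] at this
  /- (4) the captured space W := Lsym (ker ev') has finrank ≤ 3 -/
  have hWK : Module.finrank ℂ ((LinearMap.ker ev').map Lsym) = Module.finrank ℂ (LinearMap.ker ev') :=
    (LinearEquiv.finrank_eq (Submodule.equivMapOfInjective Lsym hinj (LinearMap.ker ev'))).symm
  have hcapW : Module.finrank ℂ ((LinearMap.ker ev').map Lsym) ≤ 3 := by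
    apply finrank_le_three_of_equalLines g hg
    · intro μ hμ s t
      obtain ⟨c, -, rfl⟩ := Submodule.mem_map.1 hμ
      exact hsymL c s t
    · intro μ hμ s
      obtain ⟨c, -, rfl⟩ := Submodule.mem_map.1 hμ
      exact hdiag c s
    · intro μ hμ
      obtain ⟨c, hcK, rfl⟩ := Submodule.mem_map.1 hμ
      have hmem : contractZ (Lsym c) ∈ L3 (shortSpan T S u 0 1) (shortSpan T S u 0 2) (shortSpan T S u 1 2) := by
        apply stub_obligation_captured N T S u w ⟨hcu, hcw⟩ hex hsep
        intro t ht h34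
        have h0 := congr_fun (LinearMap.mem_ker.1 hcK) ⟨t, Finset.mem_filter.2 ⟨ht, h34⟩⟩
        rw [Pi.zero_apply] at h0
        simpa [ev', hev_apply] using h0
      exact L3_le_line_form g _ _ _ (hspan 0 1 h01) (hspan 0 2 h02) (hspan 1 2 h12) _ hmem
  /- (5) count -/
  have h5 : Nat.factorial 5 = 120 := by decide
  rw [h5, hweight]
  omega

/-- **The equal-lines instance of `CaptureIneqSym`, in its own currency** (crit-3 ε1 bridge): if the three triangle spans are the
same line `ℂ·u` (`u ≠ 0` symmetric) then every captured space `W` of symmetric zero-diagonal leaf matrices has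
`finrank W ≤ finrank U₀₁ + finrank U₀₂ + finrank U₁₂ (= 3)`. [folklore] -/
theorem captureIneqSym_equalLines (u : Fin 5 → Fin 5 → ℂ) (hu : ∀ p q, u p q = u q p) (hu0 : u ≠ 0)
    (U01 U02 U12 W : Submodule ℂ (Fin 5 → Fin 5 → ℂ))
    (h01 : U01 = ℂ ∙ u) (h02 : U02 = ℂ ∙ u) (h12 : U12 = ℂ ∙ u)
    (hWs : ∀ μ ∈ W, ∀ s t : Fin 5, μ s t = μ t s) (hWd : ∀ μ ∈ W, ∀ s : Fin 5, μ s s = 0)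
    (hWc : ∀ μ ∈ W, contractZ μ ∈ L3 U01 U02 U12) :
    Module.finrank ℂ W ≤ Module.finrank ℂ U01 + Module.finrank ℂ U02 + Module.finrank ℂ U12 := by
  have hline : ∀ x ∈ (ℂ ∙ u : Submodule ℂ (Fin 5 → Fin 5 → ℂ)), ∃ κ : ℂ, x = κ • u := fun x hx => by
    obtain ⟨κ, rfl⟩ := Submodule.mem_span_singleton.mp hx
    exact ⟨κ, rfl⟩
  have h3 : Module.finrank ℂ W ≤ 3 := by
    refine finrank_le_three_of_equalLines u hu W hWs hWd fun μ hμ => ?_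
    have hmem := hWc μ hμ
    rw [h01, h02, h12] at hmem
    exact L3_le_line_form u _ _ _ hline hline hline _ hmem
  have h1 : Module.finrank ℂ (ℂ ∙ u : Submodule ℂ (Fin 5 → Fin 5 → ℂ)) = 1 := finrank_span_singleton hu0
  rw [h01, h02, h12, h1]
  exact h3

end LaplaceFiveSeparatedCapture

end Summit.ValiantsHypothesis.ValiantsHypothesis.Theorems.RigidityForcesSymmetryRankRigidMinimalRepr
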